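import Mathlib
import HarnessLib
import Literature.MathematicalPhysics.QuantumLattice.GrassmannWeightedKernelYoung
import Summits.HubbardSuperconductivity.HubbardSuperconductivity.Theorems.KLProgrammeKLRegimeTwoVolumeLipDoubledTruncStepSources
import Summits.HubbardSuperconductivity.HubbardSuperconductivity.Theorems.KLProgrammeKLRegimeTwoVolumeLipDoubledTruncIdentity
import Summits.HubbardSuperconductivity.HubbardSuperconductivity.Theorems.KLProgrammeKLRegimeTwoVolumeLipDoubledTransferRows

/-!
# Route `KLProgramme` — crux K3 ENGINE (stmt-HubbardSuperconductivity-20437), stub (e) proof-input «(e)-D-ROWS», keying (A′), REKEY-D item «DOUBLED-STEP-SOURCES» (part 2):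
# THE ONE-VOLUME TRUNCATED BORN-OUTPUT ROWS `hNB / hNBfar` OF THE SOURCE-TRUNCATED DOUBLED ASSEMBLY, FROM THE N4⁺ INPUT PROFILES, THE SECTOR COVARIANCE DATA AND THE SECTOR TRANSFER ROWS
# (seat hubbard-kl-k3c4-p1 g30; completes the N6⁺ one-volume rows of ✓ `…TwoVolumeLipDoubledTruncLawOfRowsBase1Boot`; `--supports` 23356)

The assembly's jump / re-measurement rows ask, per earlier block `k'` and degree `2m`, the RAW pinned rows `hNB` and the FAR rows `hNBfar` of the coarse truncated doubled born
increment `klLipBornDT L … d k'` (labels `SrcLabel L M (dk')`).  By ✓ DT1 `klLipBornDT_eq_srcTrunc_map_step`, `klLipBornDT = srcTrunc 3 (map (toLin' klLipTransferD) E_T)` with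
`E_T := effAction (klLipCovD …) (klLipInputDT …) − klLipInputDT …` the Born remainder of ✓ `…TruncStepSources`; so its `klScaleWt_{j_w}`-weighted profile is that of `E_T`
(✓ `truncStepSource_wt_profile_le`) transported through the doubled transfer `T ⊕ shift` by the weighted Young inequality (`Lit/GrassmannWeightedKernelYoung.sum_filter_wt_norm_kernel_map_le`),
the truncation only lowering kernels:

* §1 `klScaleWt_pair_self` (`klScaleWt {a, a} = 1`), **`rowSum_klLipTransferD_wt_le`**, **`colSum_klLipTransferD_wt_le`** — the `klScaleWt_{j_w}`-pair-weighted rows / columns of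
  `T ⊕ shift` are `≤ c_T` when those of the sector transfer `klLipTransfer` are and `1 ≤ c_T` (the plain shift has one unit entry per row / column, at the same position);
* §2 **`truncBornOutput_wt_profile_le`** — weighted pinned profile of `klLipBornDT V … d k` in degree `(2p−1)+1` `≤ c_T·c_T^{2p−1}·B(V,k,p)` (`B` = the bound of ✓ `truncStepSource_wt_profile_le`);
  **`truncBornOutput_raw_row_le`**, **`truncBornOutput_far_row_le`** (the `hNB` / `hNBfar` shapes, far row `/ (1 + Λ_{j_w}(r+1))`);
* §3 **`truncBornOutputs_rows_of_majorants`** — the PAIR `(hNB, hNBfar)` of the assembly verbatim for any arrays `NB, NBfar` dominating the §2 bounds.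

Compositions of landed theorems; every profile / row / token is a hypothesis; nothing about the model is asserted beyond them; nothing asserts the (D) rows, stub (e), VL,
K3 or superconductivity.  References: BGM 2006 §2.7 (2.70)–(2.71), §2.8 (2.61)–(2.66), (2.77)–(2.90), §3 (3.2)–(3.8) [cite: BenfattoGiulianiMastropietro2006].
-/

noncomputable section

namespace Summit.HubbardSuperconductivity.HubbardSuperconductivity.Theorems.TwoVolumeLip

set_option linter.dupNamespace false -- summit = problem name (single-conjunct summit), D-0017

open Finset Literature.MathematicalPhysics.QuantumLattice GrassmannAlgebra Literature.Probability.LatticeModels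
  Literature.Probability.LatticeModels.BattleFederbush
open Literature.MathematicalPhysics.QuantumLattice.FermiRG
open Summit.HubbardSuperconductivity.HubbardSuperconductivity.Theorems.KLRegimeSplit
open Summit.HubbardSuperconductivity.HubbardSuperconductivity.Theorems.KLProgrammeLegKernels
open Summit.HubbardSuperconductivity.HubbardSuperconductivity.Theorems.EngineV8
open Summit.HubbardSuperconductivity.HubbardSuperconductivity.Theorems.TwoVolumeSource
open Summit.HubbardSuperconductivity.HubbardSuperconductivity.Theorems.TwoVolumeDefect

/-! ## §1 The `klScaleWt`-pair-weighted rows and columns of the doubled transfer `T ⊕ shift` -/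

section TransferWt

variable {V M : ℕ} [NeZero V] [NeZero M]

/-- The scale weight of a one-point position set is `1` (`labelDiam {a} = 0`; `0 ≤ β`). -/
theorem klScaleWt_pair_self {β : ℝ} (hβ : 0 ≤ β) (jw : ℕ) (a : ZMod (2 * (2 * M)) × TorusSite 2 V) : klScaleWt V M β jw {a, a} = 1 := by
  haveI : NeZero (2 * (2 * M)) := ⟨by have := NeZero.ne M; omega⟩
  rw [pair_eq_singleton, klScaleWt_apply, labelDiam_singleton (isLabelDist_gridLabelDist V (2 * (2 * M)) hβ), mul_zero, add_zero]

/-- **Weighted ROWS of the doubled transfer**: `Σ_x ‖(T ⊕ shift) y' x‖·klScaleWt_{j_w}{pos y', pos x} ≤ c_T` if the weighted rows of `T = klLipTransfer` are `≤ c_T` and `1 ≤ c_T`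
(a copy-`1` row is a plain-shift row: at most one unit entry, at the same position, weight `1`). -/
theorem rowSum_klLipTransferD_wt_le {β : ℝ} (hβ : 0 ≤ β) (μ : ℝ) (K : TrigPolyC4v) (d k jw : ℕ) {cT : ℝ} (hcT1 : 1 ≤ cT)
    (hrowT : ∀ x, ∑ y, ‖klLipTransfer V M β μ K d k x y‖ * klScaleWt V M β jw {latticeLegPos (2 * (2 * M)) x, latticeLegPos (2 * (2 * M)) y} ≤ cT)
    (y' : SrcLabel V M (d * k)) :
    ∑ x : SrcLabel V M (d * k - 1), ‖klLipTransferD V M β μ K d k y' x‖ *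
      klScaleWt V M β jw {latticeLegPos (2 * (2 * M)) y'.1, latticeLegPos (2 * (2 * M)) x.1} ≤ cT := by
  have h10 : ¬ ((1 : Fin 2) = 0) := by decide
  have h01 : ¬ ((0 : Fin 2) = 1) := by decide
  rw [Fintype.sum_prod_type]
  rcases Fin.exists_fin_two.1 ⟨y'.2, rfl⟩ with h | h
  · simp only [Fin.sum_univ_two, klLipTransferD_apply, h, true_and, if_true, h10, h01, if_false, false_and, norm_zero, zero_mul, add_zero]
    exact hrowT y'.1
  · simp only [Fin.sum_univ_two, klLipTransferD_apply, h, h10, h01, true_and, false_and, if_false, if_true, norm_zero, zero_mul, zero_add]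
    refine le_trans (sum_le_sum fun x₁ _ => ?_) ((rowSum_norm_klPlainShift_le_one (sectorCount_pos _) y'.1 univ).trans hcT1)
    by_cases hs : klPlainShift V M (sectorCount (d * k)) (sectorCount (d * k - 1)) y'.1 x₁ = 0
    · rw [hs, norm_zero, zero_mul]
    · have he : latticeLegPos (2 * (2 * M)) x₁ = latticeLegPos (2 * (2 * M)) y'.1 := by
        unfold latticeLegPos; rw [klPlainShift_ne_zero_site hs]
      rw [he, klScaleWt_pair_self hβ, mul_one]

/-- **Weighted COLUMNS of the doubled transfer**: `Σ_{y'} ‖(T ⊕ shift) y' x‖·klScaleWt_{j_w}{pos y', pos x} ≤ c_T` likewise. -/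
theorem colSum_klLipTransferD_wt_le {β : ℝ} (hβ : 0 ≤ β) (μ : ℝ) (K : TrigPolyC4v) (d k jw : ℕ) {cT : ℝ} (hcT1 : 1 ≤ cT)
    (hcolT : ∀ y, ∑ x, ‖klLipTransfer V M β μ K d k x y‖ * klScaleWt V M β jw {latticeLegPos (2 * (2 * M)) x, latticeLegPos (2 * (2 * M)) y} ≤ cT)
    (x : SrcLabel V M (d * k - 1)) :
    ∑ y' : SrcLabel V M (d * k), ‖klLipTransferD V M β μ K d k y' x‖ *
      klScaleWt V M β jw {latticeLegPos (2 * (2 * M)) y'.1, latticeLegPos (2 * (2 * M)) x.1} ≤ cT := by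
  have h10 : ¬ ((1 : Fin 2) = 0) := by decide
  have h01 : ¬ ((0 : Fin 2) = 1) := by decide
  rw [Fintype.sum_prod_type]
  rcases Fin.exists_fin_two.1 ⟨x.2, rfl⟩ with h | h
  · simp only [Fin.sum_univ_two, klLipTransferD_apply, h, and_true, if_true, h10, h01, if_false, and_false, norm_zero, zero_mul, add_zero]
    exact hcolT x.1
  · simp only [Fin.sum_univ_two, klLipTransferD_apply, h, h10, h01, and_true, and_false, if_false, if_true, norm_zero, zero_mul, zero_add]
    refine le_trans (sum_le_sum fun y₁ _ => ?_) ((colSum_norm_klPlainShift_le_one (sectorCount_pos _) x.1).trans hcT1)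
    by_cases hs : klPlainShift V M (sectorCount (d * k)) (sectorCount (d * k - 1)) y₁ x.1 = 0
    · rw [hs, norm_zero, zero_mul]
    · have he : latticeLegPos (2 * (2 * M)) y₁ = latticeLegPos (2 * (2 * M)) x.1 := by
        unfold latticeLegPos; rw [klPlainShift_ne_zero_site hs]
      rw [he, klScaleWt_pair_self hβ, mul_one]

end TransferWt

/-! ## §2 The weighted profile of the truncated doubled born increment and its raw / far rows -/

section BornOutput

variable {V M : ℕ} [NeZero V] [NeZero M]

set_option maxHeartbeats 800000 in -- long statement, one Young transfer
/-- **THE WEIGHTED ONE-VOLUME PROFILE OF THE TRUNCATED DOUBLED BORN INCREMENT** (volume `V`, block `k` with `1 ≤ dk`, frame `K`, token `Z^K_{V,Λ_{dk}} ≠ 0`, rate `j_w`).  Data: those of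
✓ `truncStepSource_wt_profile_le` (Gram `κ`, weighted rows/cols `α` of `klLipCov V … d k`, majorant `N ≥ ε·klLipInputMeasDT … j_w (2m')`, `ρ`, `θ < 1`) and the `klScaleWt_{j_w}`-weighted
rows / columns `≤ c_T` (`1 ≤ c_T`) of the sector transfer `klLipTransfer V … d k`.  Conclusion: for `p ≥ 1`, slot `q`, pin `y'`, the weighted pinned sum of `klLipBornDT V … d k` in
degree `(2p−1)+1` is `≤ c_T·c_T^{2p−1}·B(V,k,p)` (`B` = the bound of `truncStepSource_wt_profile_le`; DT1 + weighted Young + `kernel_srcTrunc` domination).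
[cite: BenfattoGiulianiMastropietro2006, §2.7 (2.70)-(2.71), §2.9 (4.3)-(4.6), §3 (3.2)-(3.8)] -/
theorem truncBornOutput_wt_profile_le {β : ℝ} (hβ : 0 < β) (U μ : ℝ) (K : TrigPolyC4v) (d k jw : ℕ) (hdk : 1 ≤ d * k)
    (hZ : hubbardEffPartitionFnCT V M β U μ 0 K (klScale klE0 (d * k)) ≠ 0)
    {κ : ℝ} (hκ : 0 < κ) (hGB : IsGramBoundedR (klLipCov V M β μ K d k) κ)
    (N : ℕ → ℝ) (hN0 : ∀ m', 0 ≤ N m') (hN : ∀ m', imagTimeWeight β M * klLipInputMeasDT V M β U μ K d k jw (2 * m') ≤ N m')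
    {α : ℝ} (hα : 0 < α)
    (hrow : ∀ X, ∑ Y, ‖klLipCov V M β μ K d k X Y‖ * klScaleWt V M β jw {latticeLegPos (2 * (2 * M)) X, latticeLegPos (2 * (2 * M)) Y} ≤ α)
    (hcol : ∀ Y, ∑ X, ‖klLipCov V M β μ K d k X Y‖ * klScaleWt V M β jw {latticeLegPos (2 * (2 * M)) X, latticeLegPos (2 * (2 * M)) Y} ≤ α)
    {ρ : ℝ} (hρ : 0 < ρ) (hθ : Real.exp 1 * α * normV (SrcLabel V M (d * k - 1)) κ ρ N / κ ^ 2 < 1)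
    {cT : ℝ} (hcT1 : 1 ≤ cT)
    (hrowT : ∀ x, ∑ y, ‖klLipTransfer V M β μ K d k x y‖ * klScaleWt V M β jw {latticeLegPos (2 * (2 * M)) x, latticeLegPos (2 * (2 * M)) y} ≤ cT)
    (hcolT : ∀ y, ∑ x, ‖klLipTransfer V M β μ K d k x y‖ * klScaleWt V M β jw {latticeLegPos (2 * (2 * M)) x, latticeLegPos (2 * (2 * M)) y} ≤ cT)
    {p : ℕ} (hp : 1 ≤ p) (q : Fin ((2 * p - 1) + 1)) (y' : SrcLabel V M (d * k)) :
    ∑ Y' ∈ univ.filter (fun Y' : Fin ((2 * p - 1) + 1) → SrcLabel V M (d * k) => Y' q = y'),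
        ‖kernel ℂ (klLipBornDT V M β U μ K d k) ((2 * p - 1) + 1) Y'‖ * klLabelWt (klScaleWt V M β jw) ((univ.image Y').image Prod.fst) ≤
      cT * cT ^ (2 * p - 1) *
        ((∑ m' ∈ range (Fintype.card (SrcLabel V M (d * k - 1)) / 2 + 1),
            if p < m' then ((2 * m').choose (2 * p) : ℝ) * κ ^ (2 * m' - 2 * p) * N m' else 0) +
          ρ⁻¹ ^ (2 * p) * (Real.exp 1 * normV (SrcLabel V M (d * k - 1)) κ ρ N) *
            (Real.exp 1 * α * normV (SrcLabel V M (d * k - 1)) κ ρ N / κ ^ 2) / (1 - Real.exp 1 * α * normV (SrcLabel V M (d * k - 1)) κ ρ N / κ ^ 2)) := by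
  classical
  set E := effAction ℂ (klLipCovD V M β μ K d k) (klLipInputDT V M β U μ K d k) - klLipInputDT V M β U μ K d k with hE
  set B := (∑ m' ∈ range (Fintype.card (SrcLabel V M (d * k - 1)) / 2 + 1),
      if p < m' then ((2 * m').choose (2 * p) : ℝ) * κ ^ (2 * m' - 2 * p) * N m' else 0) +
    ρ⁻¹ ^ (2 * p) * (Real.exp 1 * normV (SrcLabel V M (d * k - 1)) κ ρ N) *
      (Real.exp 1 * α * normV (SrcLabel V M (d * k - 1)) κ ρ N / κ ^ 2) / (1 - Real.exp 1 * α * normV (SrcLabel V M (d * k - 1)) κ ρ N / κ ^ 2) with hB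
  have hB0 : 0 ≤ B := truncStepSource_bound_nonneg _ hκ hα hρ (normV_nonneg hκ.le hρ.le hN0) hθ N hN0 p
  -- the weighted profile of the Born remainder, in the Young door's weight shape
  have hprof : ∀ (t : Fin ((2 * p - 1) + 1)) (x : SrcLabel V M (d * k - 1)),
      ∑ X ∈ univ.filter (fun X : Fin ((2 * p - 1) + 1) → SrcLabel V M (d * k - 1) => X t = x),
        ‖kernel ℂ E ((2 * p - 1) + 1) X‖ * klScaleWt V M β jw ((univ.image X).image (latticeLegPos (2 * (2 * M)) ∘ Prod.fst)) ≤ B := by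
    intro t x
    have h := truncStepSource_wt_profile_le hβ U μ K d k jw hZ hκ hGB N hN0 hN hα hrow hcol hρ hθ hp t x
    simpa only [klLabelWt_apply, Finset.image_image, Function.comp_assoc] using h
  -- transport through `T ⊕ shift` (weighted Young)
  have hY := sum_filter_wt_norm_kernel_map_le (isTreeWeight_klScaleWt V M hβ.le jw) (latticeLegPos (2 * (2 * M)) ∘ Prod.fst)
    (latticeLegPos (2 * (2 * M)) ∘ Prod.fst) (Matrix.toLin' (klLipTransferD V M β μ K d k)) (zero_le_one.trans hcT1)
    (fun y'' => by rw [LinearMap.toMatrix'_toLin']; exact rowSum_klLipTransferD_wt_le hβ.le μ K d k jw hcT1 hrowT y'')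
    (fun x => by rw [LinearMap.toMatrix'_toLin']; exact colSum_klLipTransferD_wt_le hβ.le μ K d k jw hcT1 hcolT x)
    E (2 * p - 1) hB0 hprof q y'
  -- the truncation lowers kernels
  have hdom : ∀ X' : Fin ((2 * p - 1) + 1) → SrcLabel V M (d * k),
      ‖kernel ℂ (klLipBornDT V M β U μ K d k) ((2 * p - 1) + 1) X'‖ ≤
        ‖kernel ℂ (ExteriorAlgebra.map (Matrix.toLin' (klLipTransferD V M β μ K d k)) E) ((2 * p - 1) + 1) X'‖ := by
    intro X'
    rw [klLipBornDT_eq_srcTrunc_map_step hβ.ne' U μ K hdk hZ, kernel_srcTrunc]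
    split_ifs
    · exact le_rfl
    · rw [norm_zero]; exact norm_nonneg _
  calc ∑ Y' ∈ univ.filter (fun Y' : Fin ((2 * p - 1) + 1) → SrcLabel V M (d * k) => Y' q = y'),
        ‖kernel ℂ (klLipBornDT V M β U μ K d k) ((2 * p - 1) + 1) Y'‖ * klLabelWt (klScaleWt V M β jw) ((univ.image Y').image Prod.fst)
      ≤ ∑ Y' ∈ univ.filter (fun Y' : Fin ((2 * p - 1) + 1) → SrcLabel V M (d * k) => Y' q = y'),
          klScaleWt V M β jw ((univ.image Y').image (latticeLegPos (2 * (2 * M)) ∘ Prod.fst)) *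
            ‖kernel ℂ (ExteriorAlgebra.map (Matrix.toLin' (klLipTransferD V M β μ K d k)) E) ((2 * p - 1) + 1) Y'‖ :=
        sum_le_sum fun Y' _ => by
          rw [klLabelWt_apply, Finset.image_image, mul_comm]
          exact mul_le_mul_of_nonneg_left (hdom Y') (zero_le_one.trans (one_le_klScaleWt V M β jw _))
    _ ≤ cT * cT ^ (2 * p - 1) * B := hY

/-- **The RAW truncated born-output row** (the shape of the assembly's `hNB` at block `k'`, degree `(2m−1)+1`). -/
theorem truncBornOutput_raw_row_le {β : ℝ} (hβ : 0 < β) (U μ : ℝ) (K : TrigPolyC4v) (d k jw : ℕ) (hdk : 1 ≤ d * k)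
    (hZ : hubbardEffPartitionFnCT V M β U μ 0 K (klScale klE0 (d * k)) ≠ 0)
    {κ : ℝ} (hκ : 0 < κ) (hGB : IsGramBoundedR (klLipCov V M β μ K d k) κ)
    (N : ℕ → ℝ) (hN0 : ∀ m', 0 ≤ N m') (hN : ∀ m', imagTimeWeight β M * klLipInputMeasDT V M β U μ K d k jw (2 * m') ≤ N m')
    {α : ℝ} (hα : 0 < α)
    (hrow : ∀ X, ∑ Y, ‖klLipCov V M β μ K d k X Y‖ * klScaleWt V M β jw {latticeLegPos (2 * (2 * M)) X, latticeLegPos (2 * (2 * M)) Y} ≤ α)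
    (hcol : ∀ Y, ∑ X, ‖klLipCov V M β μ K d k X Y‖ * klScaleWt V M β jw {latticeLegPos (2 * (2 * M)) X, latticeLegPos (2 * (2 * M)) Y} ≤ α)
    {ρ : ℝ} (hρ : 0 < ρ) (hθ : Real.exp 1 * α * normV (SrcLabel V M (d * k - 1)) κ ρ N / κ ^ 2 < 1)
    {cT : ℝ} (hcT1 : 1 ≤ cT)
    (hrowT : ∀ x, ∑ y, ‖klLipTransfer V M β μ K d k x y‖ * klScaleWt V M β jw {latticeLegPos (2 * (2 * M)) x, latticeLegPos (2 * (2 * M)) y} ≤ cT)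
    (hcolT : ∀ y, ∑ x, ‖klLipTransfer V M β μ K d k x y‖ * klScaleWt V M β jw {latticeLegPos (2 * (2 * M)) x, latticeLegPos (2 * (2 * M)) y} ≤ cT)
    {p : ℕ} (hp : 1 ≤ p) (q : Fin ((2 * p - 1) + 1)) (y' : SrcLabel V M (d * k)) :
    ∑ Y' ∈ univ.filter (fun Y' : Fin ((2 * p - 1) + 1) → SrcLabel V M (d * k) => Y' q = y'),
        ‖kernel ℂ (klLipBornDT V M β U μ K d k) ((2 * p - 1) + 1) Y'‖ ≤
      cT * cT ^ (2 * p - 1) *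
        ((∑ m' ∈ range (Fintype.card (SrcLabel V M (d * k - 1)) / 2 + 1),
            if p < m' then ((2 * m').choose (2 * p) : ℝ) * κ ^ (2 * m' - 2 * p) * N m' else 0) +
          ρ⁻¹ ^ (2 * p) * (Real.exp 1 * normV (SrcLabel V M (d * k - 1)) κ ρ N) *
            (Real.exp 1 * α * normV (SrcLabel V M (d * k - 1)) κ ρ N / κ ^ 2) / (1 - Real.exp 1 * α * normV (SrcLabel V M (d * k - 1)) κ ρ N / κ ^ 2)) :=
  sum_norm_kernel_le_of_wt_profile β jw _ q y'
    (truncBornOutput_wt_profile_le hβ U μ K d k jw hdk hZ hκ hGB N hN0 hN hα hrow hcol hρ hθ hcT1 hrowT hcolT hp q y')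

/-- **The FAR truncated born-output row** (the shape of the assembly's `hNBfar` at block `k'`, degree `(2m−1)+1`, depth `r`): `≤` the §2 bound `/ (1 + Λ_{j_w}(r+1))`. -/
theorem truncBornOutput_far_row_le {β : ℝ} (hβ : 0 < β) (U μ : ℝ) (K : TrigPolyC4v) (d k jw : ℕ) (hdk : 1 ≤ d * k)
    (hZ : hubbardEffPartitionFnCT V M β U μ 0 K (klScale klE0 (d * k)) ≠ 0)
    {κ : ℝ} (hκ : 0 < κ) (hGB : IsGramBoundedR (klLipCov V M β μ K d k) κ)
    (N : ℕ → ℝ) (hN0 : ∀ m', 0 ≤ N m') (hN : ∀ m', imagTimeWeight β M * klLipInputMeasDT V M β U μ K d k jw (2 * m') ≤ N m')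
    {α : ℝ} (hα : 0 < α)
    (hrow : ∀ X, ∑ Y, ‖klLipCov V M β μ K d k X Y‖ * klScaleWt V M β jw {latticeLegPos (2 * (2 * M)) X, latticeLegPos (2 * (2 * M)) Y} ≤ α)
    (hcol : ∀ Y, ∑ X, ‖klLipCov V M β μ K d k X Y‖ * klScaleWt V M β jw {latticeLegPos (2 * (2 * M)) X, latticeLegPos (2 * (2 * M)) Y} ≤ α)
    {ρ : ℝ} (hρ : 0 < ρ) (hθ : Real.exp 1 * α * normV (SrcLabel V M (d * k - 1)) κ ρ N / κ ^ 2 < 1)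
    {cT : ℝ} (hcT1 : 1 ≤ cT)
    (hrowT : ∀ x, ∑ y, ‖klLipTransfer V M β μ K d k x y‖ * klScaleWt V M β jw {latticeLegPos (2 * (2 * M)) x, latticeLegPos (2 * (2 * M)) y} ≤ cT)
    (hcolT : ∀ y, ∑ x, ‖klLipTransfer V M β μ K d k x y‖ * klScaleWt V M β jw {latticeLegPos (2 * (2 * M)) x, latticeLegPos (2 * (2 * M)) y} ≤ cT)
    {p : ℕ} (hp : 1 ≤ p) (q : Fin ((2 * p - 1) + 1)) (y' : SrcLabel V M (d * k)) (i : Fin ((2 * p - 1) + 1)) (r : ℕ) :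
    ∑ Y' ∈ univ.filter (fun Y' : Fin ((2 * p - 1) + 1) → SrcLabel V M (d * k) => Y' q = y' ∧ r < Torus.tnorm ((Y' q).1.1.2 - (Y' i).1.1.2)),
        ‖kernel ℂ (klLipBornDT V M β U μ K d k) ((2 * p - 1) + 1) Y'‖ ≤
      cT * cT ^ (2 * p - 1) *
        ((∑ m' ∈ range (Fintype.card (SrcLabel V M (d * k - 1)) / 2 + 1),
            if p < m' then ((2 * m').choose (2 * p) : ℝ) * κ ^ (2 * m' - 2 * p) * N m' else 0) +
          ρ⁻¹ ^ (2 * p) * (Real.exp 1 * normV (SrcLabel V M (d * k - 1)) κ ρ N) *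
            (Real.exp 1 * α * normV (SrcLabel V M (d * k - 1)) κ ρ N / κ ^ 2) / (1 - Real.exp 1 * α * normV (SrcLabel V M (d * k - 1)) κ ρ N / κ ^ 2)) /
        (1 + klScale klE0 jw * ((r : ℝ) + 1)) :=
  sum_far_norm_kernel_le_of_wt_profile hβ.le jw _ q i y' r
    (truncBornOutput_wt_profile_le hβ U μ K d k jw hdk hZ hκ hGB N hN0 hN hα hrow hcol hρ hθ hcT1 hrowT hcolT hp q y')

end BornOutput

/-! ## §3 The assembly's pair `(hNB, hNBfar)` from majorant arrays -/

section Rows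

variable {L M : ℕ} [NeZero L] [NeZero M]

/-- **THE TRUNCATED BORN-OUTPUT ROWS `hNB` / `hNBfar` OF ✓ `klLipBornDiffSupDT_le_law_of_rows_base1_boot`, VERBATIM, FROM MAJORANTS** (coarse volume `L`, frame `K`, `1 ≤ d`,
blocks `1 ≤ k' < K_b`, degrees `1 ≤ m ≤ D`, depth `r`, rate `j_w`).  Data per block: token, Gram constant and weighted rows / columns of `klLipCov L … d k'`, weighted rows / columns
`≤ c_T k'` (`≥ 1`) of `klLipTransfer L … d k'`, a majorant `N k' · ≥ ε·klLipInputMeasDT L … d k' j_w (2·)`, `ρ_{k'}`, `θ_{k'} < 1`; arrays `NB, NBfar` dominating the §2 bounds. -/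
theorem truncBornOutputs_rows_of_majorants {β : ℝ} (hβ : 0 < β) (U μ : ℝ) (K : TrigPolyC4v) {d : ℕ} (hd : 1 ≤ d) (jw Kb D r : ℕ)
    (hZc : ∀ k, 1 ≤ k → k < Kb → hubbardEffPartitionFnCT L M β U μ 0 K (klScale klE0 (d * k)) ≠ 0)
    (κc αc ρc cT : ℕ → ℝ) (hκc : ∀ k, 1 ≤ k → k < Kb → 0 < κc k) (hαc : ∀ k, 1 ≤ k → k < Kb → 0 < αc k) (hρc : ∀ k, 1 ≤ k → k < Kb → 0 < ρc k)
    (hcT1 : ∀ k, 1 ≤ k → k < Kb → 1 ≤ cT k)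
    (hGBc : ∀ k, 1 ≤ k → k < Kb → IsGramBoundedR (klLipCov L M β μ K d k) (κc k))
    (hrowc : ∀ k, 1 ≤ k → k < Kb → ∀ X, ∑ Y, ‖klLipCov L M β μ K d k X Y‖ *
      klScaleWt L M β jw {latticeLegPos (2 * (2 * M)) X, latticeLegPos (2 * (2 * M)) Y} ≤ αc k)
    (hcolc : ∀ k, 1 ≤ k → k < Kb → ∀ Y, ∑ X, ‖klLipCov L M β μ K d k X Y‖ *
      klScaleWt L M β jw {latticeLegPos (2 * (2 * M)) X, latticeLegPos (2 * (2 * M)) Y} ≤ αc k)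
    (hrowT : ∀ k, 1 ≤ k → k < Kb → ∀ x, ∑ y, ‖klLipTransfer L M β μ K d k x y‖ *
      klScaleWt L M β jw {latticeLegPos (2 * (2 * M)) x, latticeLegPos (2 * (2 * M)) y} ≤ cT k)
    (hcolT : ∀ k, 1 ≤ k → k < Kb → ∀ y, ∑ x, ‖klLipTransfer L M β μ K d k x y‖ *
      klScaleWt L M β jw {latticeLegPos (2 * (2 * M)) x, latticeLegPos (2 * (2 * M)) y} ≤ cT k)
    (N : ℕ → ℕ → ℝ) (hN0 : ∀ k m', 0 ≤ N k m')
    (hN : ∀ k, 1 ≤ k → k < Kb → ∀ m', imagTimeWeight β M * klLipInputMeasDT L M β U μ K d k jw (2 * m') ≤ N k m')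
    (hθc : ∀ k, 1 ≤ k → k < Kb → Real.exp 1 * αc k * normV (SrcLabel L M (d * k - 1)) (κc k) (ρc k) (N k) / κc k ^ 2 < 1)
    (NB NBfar : ℕ → ℕ → ℝ)
    (hNBB : ∀ k, 1 ≤ k → k < Kb → ∀ m, 1 ≤ m → m ≤ D →
      cT k * cT k ^ (2 * m - 1) *
        ((∑ m' ∈ range (Fintype.card (SrcLabel L M (d * k - 1)) / 2 + 1),
            if m < m' then ((2 * m').choose (2 * m) : ℝ) * κc k ^ (2 * m' - 2 * m) * N k m' else 0) +
          (ρc k)⁻¹ ^ (2 * m) * (Real.exp 1 * normV (SrcLabel L M (d * k - 1)) (κc k) (ρc k) (N k)) *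
            (Real.exp 1 * αc k * normV (SrcLabel L M (d * k - 1)) (κc k) (ρc k) (N k) / κc k ^ 2) /
              (1 - Real.exp 1 * αc k * normV (SrcLabel L M (d * k - 1)) (κc k) (ρc k) (N k) / κc k ^ 2)) ≤ NB k m)
    (hNBfarB : ∀ k, 1 ≤ k → k < Kb → ∀ m, 1 ≤ m → m ≤ D →
      cT k * cT k ^ (2 * m - 1) *
        ((∑ m' ∈ range (Fintype.card (SrcLabel L M (d * k - 1)) / 2 + 1),
            if m < m' then ((2 * m').choose (2 * m) : ℝ) * κc k ^ (2 * m' - 2 * m) * N k m' else 0) +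
          (ρc k)⁻¹ ^ (2 * m) * (Real.exp 1 * normV (SrcLabel L M (d * k - 1)) (κc k) (ρc k) (N k)) *
            (Real.exp 1 * αc k * normV (SrcLabel L M (d * k - 1)) (κc k) (ρc k) (N k) / κc k ^ 2) /
              (1 - Real.exp 1 * αc k * normV (SrcLabel L M (d * k - 1)) (κc k) (ρc k) (N k) / κc k ^ 2)) /
        (1 + klScale klE0 jw * ((r : ℝ) + 1)) ≤ NBfar k m) :
    (∀ k', 1 ≤ k' → k' < Kb → ∀ m, 1 ≤ m → m ≤ D → ∀ (q : Fin ((2 * m - 1) + 1)) (y : SrcLabel L M (d * k')),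
      ∑ Y ∈ univ.filter (fun Y : Fin ((2 * m - 1) + 1) → SrcLabel L M (d * k') => Y q = y),
        ‖kernel ℂ (klLipBornDT L M β U μ K d k') ((2 * m - 1) + 1) Y‖ ≤ NB k' m) ∧
    (∀ k', 1 ≤ k' → k' < Kb → ∀ m, 1 ≤ m → m ≤ D → ∀ (q : Fin ((2 * m - 1) + 1)) (y : SrcLabel L M (d * k')) (i : Fin ((2 * m - 1) + 1)),
      ∑ Y ∈ univ.filter (fun Y : Fin ((2 * m - 1) + 1) → SrcLabel L M (d * k') =>
          Y q = y ∧ r < Torus.tnorm ((Y q).1.1.2 - (Y i).1.1.2)), ‖kernel ℂ (klLipBornDT L M β U μ K d k') ((2 * m - 1) + 1) Y‖ ≤ NBfar k' m) :=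
  ⟨fun k hk1 hkK m hm hmD q y =>
      (truncBornOutput_raw_row_le hβ U μ K d k jw (le_trans hd (Nat.le_mul_of_pos_right d hk1)) (hZc k hk1 hkK) (hκc k hk1 hkK) (hGBc k hk1 hkK) (N k) (hN0 k)
        (hN k hk1 hkK) (hαc k hk1 hkK) (hrowc k hk1 hkK) (hcolc k hk1 hkK) (hρc k hk1 hkK) (hθc k hk1 hkK) (hcT1 k hk1 hkK) (hrowT k hk1 hkK) (hcolT k hk1 hkK)
        hm q y).trans (hNBB k hk1 hkK m hm hmD),
    fun k hk1 hkK m hm hmD q y i =>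
      (truncBornOutput_far_row_le hβ U μ K d k jw (le_trans hd (Nat.le_mul_of_pos_right d hk1)) (hZc k hk1 hkK) (hκc k hk1 hkK) (hGBc k hk1 hkK) (N k) (hN0 k)
        (hN k hk1 hkK) (hαc k hk1 hkK) (hrowc k hk1 hkK) (hcolc k hk1 hkK) (hρc k hk1 hkK) (hθc k hk1 hkK) (hcT1 k hk1 hkK) (hrowT k hk1 hkK) (hcolT k hk1 hkK)
        hm q y i r).trans (hNBfarB k hk1 hkK m hm hmD)⟩

end Rows

end Summit.HubbardSuperconductivity.HubbardSuperconductivity.Theorems.TwoVolumeLip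

end
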